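/-
Copyright (c) 2026. All rights reserved.
Released under Apache 2.0 license as described in the file LICENSE.
Authors: abc-iut cell, seat abc-iut-L4-t6 (gen 9; row «P13viii′-NODAL-IV»).
-/
import Literature.AnabelianGeometry.AbsoluteAnabelian.AbsTopII.DehnTwistLoopEdgePairScope
import HarnessLib

/-!
# [AbsTopII] Prop 1.3 (viii′) at the nodal Dehn-twist datum MODULO CT2 (the non-fibre edge-torus centraliser)

S. Mochizuki, *Topics in Absolute Anabelian Geometry II* [AbsTopII] (`MochizukiAbsTopII2013`; kurims manuscript
`paper:url-585b8d0ad0d9`), §1, Prop 1.3 (viii) p. 12 ("… (2) `e` and `e'` are distinct, but abut to the same vertex `v`,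
and `D_e ∩ D_{e'} ∩ Π_𝔾 = {1}`.  Moreover, in the situation of (2), [for appropriate choices of conjugates of the
various inertia and decomposition groups involved] we have `I_v = D_e ∩ D_{e'} ∩ Π_I`").  Typed statement of record
`DPSCIndexData.Prop_1_3_viii'` (abc-iut-L4-t6 `InertiaGroupsScope`, p427207; `Π_𝔾`-conjugacy scope).  Nodal datum
`DehnTwist.dpsc i hi` (`Π_I = Π_H = F̂₂ ⋊_{shear^i} Ẑ`; loop node `e`, `D_e = b^Ẑ ⋊ Ẑ`; cusp `c`, `D_c = c^Ẑ × Ẑ`;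
`I_v = 1 ⋊ Ẑ`).

PROOF-ONLY file (no definition), abc-iut-L4-t6 (gen 9); sequel of `DehnTwistLoopEdgePairScope.lean` (structural
`I_v`-clause `S_eq_conj_range_inr` and its two unconditional cases).
* `exists_conj_range_inr_eq_S_of_CT2` — for `S_g := D_e ⊓ (g,1)·D_c·(g,1)⁻¹ ≠ 1` there is `h ∈ F̂₂` (in fact
  `h ∈ {1, a⁻¹}`) with `S_g = (h,1)·I_v·(h,1)⁻¹`, MODULO the displayed input
  «CT2: `∀ u k x, k ≠ 1 → b^u ≠ 1 → b^u ≠ b^{k^i} → shear^i(k) x = b^{-u} x b^{u} → x ∈ Π_e`»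
  (= in `Π_I`, the centraliser in `Π_𝔾` of a NON-FIBRE element `(b^u,k)` of the edge torus `D_e ≅ Ẑ²` lies in `b^Ẑ`;
  discrete shadow: centralisers in the graph manifold group `F₂ ⋊_{Dehn} ℤ` / Bass–Serre; NOT in the tree): a non-trivial
  `z = (b^u, k) ∈ S_g` has `k ≠ 1`; `b^u = 1` and `b^u = b^{k^i}` are the unconditional cases; otherwise CT2 applied to
  `x = g c₀ g⁻¹` (`c₀ = c^{ι 1} ≠ 1`, on which `shear^i(k)` acts as conjugation by `b^{-u}`) puts `x` in
  `Π_e ∩ g Π_c g⁻¹ = 1` (abc-iut-f-069 `nodeGp_inf_conj_cuspGp_eq_bot`) — absurd;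
* **`prop_1_3_viii'_dpsc_of_CT2`** — the typed `Prop_1_3_viii'` HOLDS at `dpsc i hi` MODULO CT2 (pairs of equal edge
  type: `e = e'`; (node, cusp): the previous theorem + the `Π_𝔾`-clause of abc-iut-f-069 p468661; (cusp, node):
  conjugate by `γ` and swap, `Π_𝔾` being normal).  GAP row G-L4t6g8-2 is thereby NARROWED to CT2 exactly.
HONEST FRAMING: classical profinite group theory at a constructed model (constructed ≠ geometric); the typed (viii′) row is
proved here only MODULO CT2 (displayed, not smuggled); consistency evidence, not a discharge at geometric data; nothing
here bears on [IUTchIII] Cor 3.12; no side taken.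
Doc v2 (abc-iut-L4-t6 gen 12; referee finding ref-l L14-n4, site 2): the «Moreover»-bracket of the Prop 1.3 (viii)
quotation above is restored verbatim; every declaration below is byte-identical to doc v1 (p487638).
-/

noncomputable section

open scoped Pointwise

namespace Literature.AnabelianGeometry.AbsoluteAnabelian.AbsTopII.DehnTwist

open Literature.AnabelianGeometry.EtaleTheta.SettingModel
open Literature.AnabelianGeometry.EtaleTheta
open Function _root_.Topology

/-! ### §3 The typed `Prop_1_3_viii'` at `dpsc i hi` modulo CT2 -/

/-- **The `I_v`-clause of Prop 1.3 (viii′) at the nodal datum for an ARBITRARY `Π_𝔾`-conjugate, MODULO CT2.**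
If `S_g ≠ 1` then `S_g = (h,1)·I_v·(h,1)⁻¹` for some `h ∈ F̂₂` (in fact `h ∈ {1, a⁻¹}`): a non-trivial
`z = (b^u, k) ∈ S_g` has `k ≠ 1` (`S_g ∩ Π_𝔾 = 1`); `b^u = 1` and `b^u = b^{k^i}` are §2; otherwise CT2 applied to
`x = g c₀ g⁻¹` (`c₀ = c^{ι 1} ≠ 1`), on which `shear^i(k)` acts as conjugation by `b^{-u}`, puts `x` in
`Π_e ∩ g Π_c g⁻¹ = 1` — absurd. [cite: MochizukiAbsTopII2013, Prop 1.3 (viii) p.12] -/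
theorem exists_conj_range_inr_eq_S_of_CT2 {i : ℕ} (hi : 0 < i)
    (CT2 : ∀ (u k : ZH) (x : F₂hatT), k ≠ 1 → bPow u ≠ 1 → bPow u ≠ bPow (k ^ i) →
      shearPow i k x = (bPow u)⁻¹ * x * bPow u → x ∈ nodeGp)
    (g : F₂hatT)
    (hS : Subgroup.normalizer ((nodeGp.map (SemidirectProduct.inl : F₂hatT →* Ext i) : Subgroup (Ext i)) : Set (Ext i)) ⊓
        MulAut.conj (SemidirectProduct.inl g : Ext i) •
          Subgroup.normalizer ((cuspGp.map (SemidirectProduct.inl : F₂hatT →* Ext i) : Subgroup (Ext i)) :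
            Set (Ext i)) ≠ ⊥) :
    ∃ h : F₂hatT, MulAut.conj (SemidirectProduct.inl h : Ext i) • (SemidirectProduct.inr : ZH →* Ext i).range =
      Subgroup.normalizer ((nodeGp.map (SemidirectProduct.inl : F₂hatT →* Ext i) : Subgroup (Ext i)) : Set (Ext i)) ⊓
        MulAut.conj (SemidirectProduct.inl g : Ext i) •
          Subgroup.normalizer ((cuspGp.map (SemidirectProduct.inl : F₂hatT →* Ext i) : Subgroup (Ext i)) :
            Set (Ext i)) := by
  obtain ⟨⟨z, hzS⟩, hz1⟩ := Subgroup.ne_bot_iff_exists_ne_one.mp hS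
  have hz1' : z ≠ 1 := fun h => hz1 (Subtype.ext h)
  obtain ⟨hze, hzc⟩ := Subgroup.mem_inf.mp hzS
  -- `z = (b^u, k)`
  have hzl : z.left ∈ nodeGp := (mem_normalizer_node_iff i z).mp hze
  obtain ⟨u, hu⟩ : ∃ u : ZH, bPow u = z.left := hzl
  set k := z.right with hk_def
  have hzeq : z = SemidirectProduct.inl (bPow u) * SemidirectProduct.inr k := by
    rw [hu, hk_def, SemidirectProduct.inl_left_mul_inr_right]
  -- `k ≠ 1` (else `z ∈ S_g ∩ Π_𝔾 = 1`)
  have hk : k ≠ 1 := by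
    intro hk1
    have hbot := normalizer_node_inf_conj_normalizer_cusp_inf_range_inl i (SemidirectProduct.inl g)
    have hmem : z ∈ Subgroup.normalizer ((nodeGp.map (SemidirectProduct.inl : F₂hatT →* Ext i) :
        Subgroup (Ext i)) : Set (Ext i)) ⊓ MulAut.conj (SemidirectProduct.inl g : Ext i) •
          Subgroup.normalizer ((cuspGp.map (SemidirectProduct.inl : F₂hatT →* Ext i) : Subgroup (Ext i)) :
            Set (Ext i)) ⊓ (SemidirectProduct.inl : F₂hatT →* Ext i).range :=
      Subgroup.mem_inf.mpr ⟨hzS, ⟨bPow u, by rw [hzeq, hk1, map_one, mul_one]⟩⟩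
    rw [hbot, Subgroup.mem_bot] at hmem
    exact hz1' hmem
  by_cases hu1 : bPow u = 1
  · refine ⟨1, ?_⟩
    rw [map_one, map_one, one_smul]
    refine (S_eq_range_inr_of_inr_mem hi g hk ?_).symm
    have : z = SemidirectProduct.inr k := by rw [hzeq, hu1, map_one, one_mul]
    rw [← this]
    exact hzS
  by_cases hu2 : bPow u = bPow (k ^ i)
  · refine ⟨genA⁻¹, ?_⟩
    rw [map_inv]
    refine (S_eq_conj_genA_inv_range_inr_of_mem hi g hk ?_).symm
    rw [← hu2, ← hzeq]
    exact hzS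
  -- the remaining case is excluded by CT2
  exfalso
  have hc : g⁻¹ * bPow u * shearPow i k g ∈ cuspGp := by
    have := (mem_conj_normalizer_cusp_iff i g z).mp hzc
    rwa [← hu] at this
  set c₁ := g⁻¹ * bPow u * shearPow i k g with hc₁
  have hσg : shearPow i k g = (bPow u)⁻¹ * g * c₁ := by rw [hc₁]; group
  set c₀ : F₂hatT := cPow (iotaZ (Multiplicative.ofAdd 1)) with hc₀
  have hc₀mem : c₀ ∈ cuspGp := by rw [cuspGp_eq_cAxis]; exact cPow_mem_cAxis _
  have hc₀ne : c₀ ≠ 1 := fun h => iotaZ_one_ne_one (cPow_injective (h.trans (map_one cPow).symm))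
  set x : F₂hatT := g * c₀ * g⁻¹ with hx
  have hrel : shearPow i k x = (bPow u)⁻¹ * x * bPow u := by
    have hcomm := commute_of_mem_cuspGp hc hc₀mem
    rw [hx, map_mul, map_mul, map_inv, shearPow_mem_cuspGp i k c₀ hc₀mem, hσg]
    calc (bPow u)⁻¹ * g * c₁ * c₀ * ((bPow u)⁻¹ * g * c₁)⁻¹
        = (bPow u)⁻¹ * g * (c₁ * c₀) * c₁⁻¹ * g⁻¹ * bPow u := by group
      _ = (bPow u)⁻¹ * g * (c₀ * c₁) * c₁⁻¹ * g⁻¹ * bPow u := by rw [hcomm]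
      _ = (bPow u)⁻¹ * (g * c₀ * g⁻¹) * bPow u := by group
  have hxn : x ∈ nodeGp := CT2 u k x hk hu1 hu2 hrel
  have hxc : x ∈ MulAut.conj g • cuspGp := by
    rw [Subgroup.mem_smul_pointwise_iff_exists]
    exact ⟨c₀, hc₀mem, by rw [MulAut.smul_def, MulAut.conj_apply]⟩
  have hbot : x ∈ nodeGp ⊓ MulAut.conj g • cuspGp := Subgroup.mem_inf.mpr ⟨hxn, hxc⟩
  rw [nodeGp_inf_conj_cuspGp_eq_bot, Subgroup.mem_bot, hx] at hbot
  exact hc₀ne (by simpa using hbot)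

/-- **[AbsTopII] Prop 1.3 (viii′) — the typed `DPSCIndexData.Prop_1_3_viii'` — HOLDS at the nodal Dehn-twist datum
`dpsc i hi` MODULO the single displayed input CT2** (centraliser of a non-fibre element of the edge torus; GAP row
G-L4t6g8-2 narrowed to it).  Pairs of equal edge type fall under `e = e'`; the pair (node, cusp) is
`exists_conj_range_inr_eq_S_of_CT2` with the `Π_𝔾`-clause of abc-iut-f-069 (p468661); the pair (cusp, node) is reduced
to it by conjugating with `γ`. [cite: MochizukiAbsTopII2013, Prop 1.3 (viii) p.12] -/
theorem prop_1_3_viii'_dpsc_of_CT2 {i : ℕ} (hi : 0 < i)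
    (CT2 : ∀ (u k : ZH) (x : F₂hatT), k ≠ 1 → bPow u ≠ 1 → bPow u ≠ bPow (k ^ i) →
      shearPow i k x = (bPow u)⁻¹ * x * bPow u → x ∈ nodeGp) :
    Literature.AnabelianGeometry.AbsoluteAnabelian.AbsTopII.DPSCIndexData.Prop_1_3_viii' (dpsc i hi) := by
  intro e e' γ hγ hne
  obtain ⟨g, rfl⟩ : ∃ g : F₂hatT, SemidirectProduct.inl g = γ := hγ
  rcases e with ⟨⟨⟩⟩ | ⟨⟨⟩⟩ <;> rcases e' with ⟨⟨⟩⟩ | ⟨⟨⟩⟩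
  · exact Or.inl rfl
  · -- (node, cusp)
    right
    have hS : Subgroup.normalizer ((nodeGp.map (SemidirectProduct.inl : F₂hatT →* Ext i) : Subgroup (Ext i)) :
        Set (Ext i)) ⊓ MulAut.conj (SemidirectProduct.inl g : Ext i) •
          Subgroup.normalizer ((cuspGp.map (SemidirectProduct.inl : F₂hatT →* Ext i) : Subgroup (Ext i)) :
            Set (Ext i)) ≠ ⊥ := by
      intro h
      apply hne
      change Subgroup.normalizer ((nodeGp.map (SemidirectProduct.inl : F₂hatT →* Ext i) : Subgroup (Ext i)) :
          Set (Ext i)) ⊓ MulAut.conj (SemidirectProduct.inl g : Ext i) •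
            Subgroup.normalizer ((cuspGp.map (SemidirectProduct.inl : F₂hatT →* Ext i) : Subgroup (Ext i)) :
              Set (Ext i)) ⊓ ⊤ = ⊥
      rw [inf_top_eq, h]
    obtain ⟨h, hh⟩ := exists_conj_range_inr_eq_S_of_CT2 hi CT2 g hS
    refine ⟨Sum.inl_ne_inr, ⟨()⟩, Sym2.mem_iff.mpr (Or.inl rfl), rfl,
      DEdge_node_inf_conj_DEdge_cusp_inf_PiG_dpsc hi ⟨()⟩ ⟨()⟩ _, SemidirectProduct.inl h, ⟨h, rfl⟩, ?_⟩
    rw [Iv_dpsc_eq_range_inr_holds hi]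
    change MulAut.conj (SemidirectProduct.inl h : Ext i) • (SemidirectProduct.inr : ZH →* Ext i).range =
      Subgroup.normalizer ((nodeGp.map (SemidirectProduct.inl : F₂hatT →* Ext i) : Subgroup (Ext i)) :
          Set (Ext i)) ⊓ MulAut.conj (SemidirectProduct.inl g : Ext i) •
            Subgroup.normalizer ((cuspGp.map (SemidirectProduct.inl : F₂hatT →* Ext i) : Subgroup (Ext i)) :
              Set (Ext i)) ⊓ ⊤
    rw [inf_top_eq]
    exact hh
  · -- (cusp, node): conjugate by `γ` and swap
    right
    have hswap : Subgroup.normalizer ((cuspGp.map (SemidirectProduct.inl : F₂hatT →* Ext i) : Subgroup (Ext i)) :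
        Set (Ext i)) ⊓ MulAut.conj (SemidirectProduct.inl g : Ext i) •
          Subgroup.normalizer ((nodeGp.map (SemidirectProduct.inl : F₂hatT →* Ext i) : Subgroup (Ext i)) :
            Set (Ext i)) =
        MulAut.conj (SemidirectProduct.inl g : Ext i) •
          (Subgroup.normalizer ((nodeGp.map (SemidirectProduct.inl : F₂hatT →* Ext i) : Subgroup (Ext i)) :
              Set (Ext i)) ⊓ MulAut.conj (SemidirectProduct.inl g⁻¹ : Ext i) •
            Subgroup.normalizer ((cuspGp.map (SemidirectProduct.inl : F₂hatT →* Ext i) : Subgroup (Ext i)) :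
              Set (Ext i))) := by
      rw [Subgroup.smul_inf, smul_smul, ← map_mul, ← map_mul, mul_inv_cancel, map_one, map_one, one_smul, inf_comm]
    have hS : Subgroup.normalizer ((nodeGp.map (SemidirectProduct.inl : F₂hatT →* Ext i) : Subgroup (Ext i)) :
        Set (Ext i)) ⊓ MulAut.conj (SemidirectProduct.inl g⁻¹ : Ext i) •
          Subgroup.normalizer ((cuspGp.map (SemidirectProduct.inl : F₂hatT →* Ext i) : Subgroup (Ext i)) :
            Set (Ext i)) ≠ ⊥ := by
      intro h
      apply hne
      change Subgroup.normalizer ((cuspGp.map (SemidirectProduct.inl : F₂hatT →* Ext i) : Subgroup (Ext i)) :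
          Set (Ext i)) ⊓ MulAut.conj (SemidirectProduct.inl g : Ext i) •
            Subgroup.normalizer ((nodeGp.map (SemidirectProduct.inl : F₂hatT →* Ext i) : Subgroup (Ext i)) :
              Set (Ext i)) ⊓ ⊤ = ⊥
      rw [inf_top_eq, hswap, h, Subgroup.smul_bot]
    obtain ⟨h, hh⟩ := exists_conj_range_inr_eq_S_of_CT2 hi CT2 g⁻¹ hS
    refine ⟨Sum.inr_ne_inl, ⟨()⟩, rfl, Sym2.mem_iff.mpr (Or.inl rfl), ?_,
      SemidirectProduct.inl (g * h), ⟨g * h, rfl⟩, ?_⟩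
    · -- `Π_𝔾`-clause for the swapped pair: conjugate f-069's clause (Π_𝔾 is normal)
      change Subgroup.normalizer ((cuspGp.map (SemidirectProduct.inl : F₂hatT →* Ext i) : Subgroup (Ext i)) :
          Set (Ext i)) ⊓ MulAut.conj (SemidirectProduct.inl g : Ext i) •
            Subgroup.normalizer ((nodeGp.map (SemidirectProduct.inl : F₂hatT →* Ext i) : Subgroup (Ext i)) :
              Set (Ext i)) ⊓ (SemidirectProduct.inl : F₂hatT →* Ext i).range = ⊥
      haveI := normal_range_inl i
      rw [hswap, ← Subgroup.Normal.conj_smul_eq_self (SemidirectProduct.inl g : Ext i)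
        ((SemidirectProduct.inl : F₂hatT →* Ext i).range), ← Subgroup.smul_inf,
        normalizer_node_inf_conj_normalizer_cusp_inf_range_inl i (SemidirectProduct.inl g⁻¹), Subgroup.smul_bot]
    · rw [Iv_dpsc_eq_range_inr_holds hi]
      change MulAut.conj (SemidirectProduct.inl (g * h) : Ext i) • (SemidirectProduct.inr : ZH →* Ext i).range =
        Subgroup.normalizer ((cuspGp.map (SemidirectProduct.inl : F₂hatT →* Ext i) : Subgroup (Ext i)) :
            Set (Ext i)) ⊓ MulAut.conj (SemidirectProduct.inl g : Ext i) •
              Subgroup.normalizer ((nodeGp.map (SemidirectProduct.inl : F₂hatT →* Ext i) : Subgroup (Ext i)) :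
                Set (Ext i)) ⊓ ⊤
      rw [inf_top_eq, hswap, ← hh, smul_smul, ← map_mul, ← map_mul]
  · exact Or.inl rfl

end Literature.AnabelianGeometry.AbsoluteAnabelian.AbsTopII.DehnTwist

end
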